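import Literature.RingTheory.KTheory.MilnorKWittRingRatFuncExactSequence
import HarnessLib

/-!
# LEMMA 5.7: the sequence `0 → IⁿF → IⁿF(t) → ⊕_π Iⁿ⁻¹(F[t]/(π)) → 0` is exact (`n ≥ 1`)
# (Milnor, *Algebraic K-theory and quadratic forms*, Invent. Math. 9 (1970), §5)

Family `hodge`, lane `lit-hodgefound` (foundations library; seat `lit-hodgefound-p27`, generation 42, row g42-#3);
topic `RingTheory/KTheory`.  Sequel of `MilnorKWittRingRatFuncExactSequence` (g42-#2: Theorem 5.3
`forall_boundaryAtW_eq_zero_iff`, `exists_forall_boundaryAtW_eq`, `bijective_retraction_prod_boundaryFamilyW`), of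
`MilnorKWittRingRatFuncFiltration` (g42-#1: `quotRep`/`repPolyUnit`, `resAt_repPolyUnit`), of
`MilnorKWittRingRatFuncResidues` (g41-#7: `boundaryAtW`, `boundaryAtW_mem_pow` «each ∂_π maps IⁿE to Iⁿ⁻¹Ē_π»,
`constMapW_mem_pow`, `retraction_mem_pow`, `retraction_constMapW`) and of `MilnorKWittRingResidue` (g41-#6: Springer's
ring homomorphism `springer : W(K) →+* W(K̄)[ℤ/2]`, `sndResidue = ∂`, `rho = ρ`, `coeff_one_mul`).  THEOREMS ONLY (no
`def`, no named fact, no instance, no notation), 0 `sorry`, net debt 0 (D-0026).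

## The source, verbatim

J. Milnor, *Algebraic K-theory and quadratic forms*, Invent. Math. 9 (1970) 318–344 (held `paper:doi-10-1007-bf01425486`;
bib key `Milnor1970`), §5 (p0021 L25 – p0022 L10): «Now let us bring the multiplicative structure of W into Theorem
5.3. Again let E = F(t). **LEMMA 5.7.** The sequence 5.3 gives rise to an exact sequence
0 → IⁿF → IⁿE → ⊕ Iⁿ⁻¹Ē_π → 0 for any n ≥ 1. *Proof.* The proof of 5.2 shows that each ∂_π maps IⁿE to Iⁿ⁻¹Ē_π.
Consider any generator η = ((f̄₂) − (1))⋯((f̄ₙ) − (1)) of Iⁿ⁻¹Ē_π. Let degree π = d. Then the product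
ζ = ((π) − (1))((f₂) − (1))⋯((fₙ) − (1)) in IⁿE, where each representative fᵢ has degree < d, satisfies ∂_π ζ = η,
and satisfies ∂_{π′} ζ = 0 for every π′ ≠ π with degree π′ ≥ d. Now, given any element (η_π) of ⊕ Iⁿ⁻¹Ē_π, let
d₀ = Max {degree π | η_π ≠ 0}. Then it follows by induction on d₀ that (η_π) is the image of some element in IⁿE. To
prove exactness in the middle of the sequence 5.7, consider any ξ ∈ IⁿE which maps to zero in ⊕ Iⁿ⁻¹Ē_π. According
to 5.3, ξ comes from some element ζ of WF. Now apply the homomorphism ρ of §5.4. Evidently ρ maps IⁿE into IⁿF, and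
evidently ρ(ξ) = ζ. This proves that ζ ∈ IⁿF, which completes the proof of 5.7.»

## What is formalised (`E = F(t) = RatFunc F`, `∂_𝔭 = boundaryAtW F 𝔭`, `κ_𝔭 = ResidueFieldAt F[t] F(t) 𝔭`, `I = fundIdeal`;
Milnor's `n ≥ 1` is our `n + 1`)

* §1 (any discretely valued field `K`, uniformizer `π`) the residues of products with unit factors, through Springer's
  ring homomorphism: on the subring generated by the `(u)`, `v(u) = 0`, `springer M = (ρ M)·t⁰`
  (`springer_eq_single_rho_of_mem_closure`), hence **`∂ M = 0`** (`sndResidue_eq_zero_of_mem_closure`) and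
  **`∂(((π) − (1)) M) = ρ M`** (`sndResidue_gen_pi_sub_one_mul`) — the computation «∂_π ζ = η».
* §2 (any field `K`) **`Iᵐ(K)` is additively generated by the products `(g)((f₁) − (1))⋯((f_m) − (1))`**
  (`mem_closure_prodGens_of_mem_pow`; Milnor's «generator η = ((f̄₂) − (1))⋯((f̄ₙ) − (1)) of Iⁿ⁻¹Ē_π», read additively —
  the extra unit factor `(g)` accounts for the `W`-module structure, `(g)((f) − (1)) = ((gf) − (1)) − ((g) − (1))`).
* §3 the lifts `ζ = ((π) − (1))(g̃)((f̃₂) − (1))⋯` in `Iᵐ⁺¹E` with `∂_𝔭 ζ = η`, `∂_𝔮 ζ = 0` for `𝔮 ≠ 𝔭` of degree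
  `≥ deg 𝔭` (`exists_mem_pow_boundaryAtW_eq_and_eq_zero`), the «induction on d₀»
  (`exists_mem_pow_forall_boundaryAtW_eq_of_support`) and **LEMMA 5.7, EXACTNESS AT `⊕`**: every finitely supported
  `(η_𝔭)`, `η_𝔭 ∈ Iᵐ(κ_𝔭)`, is `(∂_𝔭 u)_𝔭` for some `u ∈ Iᵐ⁺¹E` (**`exists_mem_pow_forall_boundaryAtW_eq`**; no
  characteristic assumption).
* §4 **EXACTNESS IN THE MIDDLE** («According to 5.3, ξ comes from some element ζ of WF. Now apply the homomorphism ρ»):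
  `mem_pow_iff_constMapW_mem_pow` (`ι ζ ∈ IⁿE ↔ ζ ∈ IⁿF`, by `ρ`) and **`exists_mem_pow_constMapW_eq`** (`char F ≠ 2`,
  through Theorem 5.3); exactness at `IⁿF` is g41-#7's `constMapW_injective` with `constMapW_mem_pow`.
* §5 LEMMA 5.7 packaged: `w ↦ (ρ w, (∂_𝔭 w)_𝔭)` restricts to a bijection
  `Iⁿ⁺¹E → Iⁿ⁺¹F × ⊕_𝔭 Iⁿ(κ_𝔭)` (**`bijOn_pow_retraction_prod_boundaryFamilyW`**, `char F ≠ 2`).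
* Not here: Corollary 5.8 (Questions 4.3/4.4 for `F(t)`; conditional on conjecture leaves).

## References

* [Milnor1970] J. Milnor, *Algebraic K-theory and quadratic forms*, Invent. Math. 9 (1970) 318–344 — §5 Lemma 5.7 and
  its proof (p0021 L25 – p0022 L10); Cor. 5.2 and its proof «IⁿE = IⁿĒ ⊕ ((π) − (1))Iⁿ⁻¹Ē» (p0017 L26–L35); Theorem
  5.3 (p0018 L12–L15), Lemma 5.4 (p0018 L27–L44).
* [Knebusch2010] M. Knebusch, *Specialization of Quadratic and Symmetric Bilinear Forms*, Algebra and Applications 11,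
  Springer (2010) — §3.4 Thm. 3.34 (PDF p. 143), the module structure «The maps ∂_p are W(k)-linear» (PDF p. 143).

Provenance: lane `lit-hodgefound`, seat `lit-hodgefound-p27` gen 42 (agent `literature-prover-lit-hodgefound-p27-g42-0`),
row g42-#3.
-/

set_option autoImplicit false

noncomputable section

namespace Literature.RingTheory.KTheory

open Function Polynomial IsDedekindDomain

namespace WittRing

/-! ### §1 Residues of products with unit factors -/

section UnitSubring

variable {K : Type*} [Field K] (v : Valuation K (WithZero (Multiplicative ℤ))) {π : Kˣ} (hπ : addVal v π = 1)

/-- On the subring of `W(K)` generated by the classes `(u)` of units, Springer's homomorphism is `M ↦ (ρ M)·t⁰` («WE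
splits additively as the direct sum of W₀ and (π)W₀» — these elements lie in `W₀`). [cite: Milnor1970, §5 Springer's theorem (p0017 L5–L10); proof of Cor. 5.2 (p0017 L28–L33)] -/
theorem springer_eq_single_rho_of_mem_closure {M : WittRing K}
    (hM : M ∈ Subring.closure (gen K '' {u : Kˣ | addVal v u = 0})) :
    springer v hπ M = AddMonoidAlgebra.single 0 (rho v hπ M) := by
  induction hM using Subring.closure_induction with
  | mem x hx =>
    obtain ⟨u, hu, rfl⟩ := hx
    rw [springer_gen_of_addVal_eq_zero v hπ hu, rho_gen]
  | zero => rw [map_zero, map_zero, AddMonoidAlgebra.single_zero]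
  | one => rw [map_one, map_one, AddMonoidAlgebra.one_def]
  | add x y _ _ hx hy => rw [map_add, map_add, hx, hy, AddMonoidAlgebra.single_add]
  | neg x _ hx => rw [map_neg, map_neg, hx, AddMonoidAlgebra.single_neg]
  | mul x y _ _ hx hy => rw [map_mul, map_mul, hx, hy, AddMonoidAlgebra.single_mul_single, add_zero]

/-- **`∂ M = 0`** for `M` in the subring generated by the unit classes («∂(u) = 0», multiplicatively closed).
[cite: Milnor1970, §5 Cor. 5.1 «∂(u) = 0» (p0017 L16–L22); proof of Lemma 5.7 «∂_{π′} ζ = 0 for every π′ ≠ π with degree π′ ≥ d» (p0021 L36–L37)] -/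
theorem sndResidue_eq_zero_of_mem_closure {M : WittRing K}
    (hM : M ∈ Subring.closure (gen K '' {u : Kˣ | addVal v u = 0})) : sndResidue v hπ M = 0 := by
  rw [sndResidue_apply, springer_eq_single_rho_of_mem_closure v hπ hM, ← coeffHom_apply,
    coeffHom_single_of_ne v (by decide : (1 : ZMod 2) ≠ 0)]

/-- **`∂(((π) − (1))·M) = ρ M`** for `M` in the subring generated by the unit classes — the computation «the product
ζ = ((π) − (1))((f₂) − (1))⋯((fₙ) − (1)) […] satisfies ∂_π ζ = η». [cite: Milnor1970, §5 proof of Lemma 5.7 (p0021 L31–L37); proof of Cor. 5.2 «IⁿE = IⁿĒ ⊕ ((π) − (1))Iⁿ⁻¹Ē» (p0017 L32–L33)] -/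
theorem sndResidue_gen_pi_sub_one_mul {M : WittRing K}
    (hM : M ∈ Subring.closure (gen K '' {u : Kˣ | addVal v u = 0})) :
    sndResidue v hπ ((gen K π - 1) * M) = rho v hπ M := by
  have h1 : springer v hπ ((gen K π - 1) * M) =
      AddMonoidAlgebra.single 1 (rho v hπ M) - AddMonoidAlgebra.single 0 (rho v hπ M) := by
    rw [map_mul, map_sub, map_one, springer_gen_pi, springer_eq_single_rho_of_mem_closure v hπ hM, sub_mul, one_mul,
      AddMonoidAlgebra.single_mul_single, add_zero, one_mul]
  rw [sndResidue_apply, h1, ← coeffHom_apply, map_sub, coeffHom_single_self,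
    coeffHom_single_of_ne v (by decide : (1 : ZMod 2) ≠ 0), sub_zero]

/-- `ρ` of the lifted generator: `ρ((g)·∏((fᵢ) − (1))) = (ḡ)·∏((f̄ᵢ) − (1))`. [cite: Milnor1970, §5 proof of Lemma 5.7 «∂_π ζ = η» (p0021 L31–L36); Lemma 5.4 «ρ(u) = (ū)» (p0018 L33)] -/
theorem rho_gen_mul_prod {m : ℕ} (g : Kˣ) (f : Fin m → Kˣ) :
    rho v hπ (gen K g * (List.ofFn fun i => gen K (f i) - 1).prod) =
      gen (ValResidueField v) (res v hπ g) *
        (List.ofFn fun i => gen (ValResidueField v) (res v hπ (f i)) - 1).prod := by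
  simp only [map_mul, map_list_prod, List.map_ofFn, Function.comp_def, map_sub, map_one, rho_gen]

/-- The lifted generator `(g)·∏((fᵢ) − (1))` lies in the unit subring when `g` and the `fᵢ` are units. [cite: Milnor1970, §5 proof of Lemma 5.7 «where each representative fᵢ has degree < d» (p0021 L35–L36)] -/
theorem gen_mul_prod_mem_closure {m : ℕ} {g : Kˣ} (hg : addVal v g = 0) {f : Fin m → Kˣ}
    (hf : ∀ i, addVal v (f i) = 0) :
    gen K g * (List.ofFn fun i => gen K (f i) - 1).prod ∈ Subring.closure (gen K '' {u : Kˣ | addVal v u = 0}) := by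
  refine mul_mem (Subring.subset_closure ⟨g, hg, rfl⟩) (list_prod_mem ?_)
  intro x hx
  rw [List.mem_ofFn] at hx
  obtain ⟨i, rfl⟩ := hx
  exact sub_mem (Subring.subset_closure ⟨f i, hf i, rfl⟩) (one_mem _)

end UnitSubring

/-! ### §2 `Iᵐ(K)` is additively generated by the `(g)((f₁) − (1))⋯((f_m) − (1))` -/

section Generators

open Pointwise

variable (K : Type*) [Field K]

/-- The subgroup generated by the `(g)·∏_{i<m}((fᵢ) − (1))` is closed under multiplication by any `(b)` (hence is a
`W(K)`-submodule). [cite: Milnor1970, §4 «the elements (a) − (1) form an additive set of generators for the ideal I» (p0015 L10–L12); §5 proof of Lemma 5.7 «any generator η […] of Iⁿ⁻¹Ē_π» (p0021 L31–L33)] -/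
theorem gen_mul_mem_closure_prodGens {m : ℕ} (b : Kˣ) {z : WittRing K}
    (hz : z ∈ AddSubgroup.closure
      {x : WittRing K | ∃ (g : Kˣ) (f : Fin m → Kˣ), gen K g * (List.ofFn fun i => gen K (f i) - 1).prod = x}) :
    gen K b * z ∈ AddSubgroup.closure
      {x : WittRing K | ∃ (g : Kˣ) (f : Fin m → Kˣ), gen K g * (List.ofFn fun i => gen K (f i) - 1).prod = x} := by
  induction hz using AddSubgroup.closure_induction with
  | mem x hx =>
    obtain ⟨g, f, rfl⟩ := hx
    exact AddSubgroup.subset_closure ⟨b * g, f, by rw [gen_mul, mul_assoc]⟩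
  | zero => rw [mul_zero]; exact zero_mem _
  | add x y _ _ hx hy => rw [mul_add]; exact add_mem hx hy
  | neg x _ hx => rw [mul_neg]; exact neg_mem hx

/-- The same subgroup is closed under multiplication by all of `W(K)` («W(K) is additively generated by the (a)»).
[cite: Milnor1970, §5 proof of Lemma 5.6 «the additive group of WF has a presentation in terms of generators (a)» (p0020 L11–L13); proof of Lemma 5.7 (p0021 L31–L33)] -/
theorem mul_mem_closure_prodGens {m : ℕ} (a : WittRing K) {z : WittRing K}
    (hz : z ∈ AddSubgroup.closure
      {x : WittRing K | ∃ (g : Kˣ) (f : Fin m → Kˣ), gen K g * (List.ofFn fun i => gen K (f i) - 1).prod = x}) :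
    a * z ∈ AddSubgroup.closure
      {x : WittRing K | ∃ (g : Kˣ) (f : Fin m → Kˣ), gen K g * (List.ofFn fun i => gen K (f i) - 1).prod = x} := by
  have ha : a ∈ AddSubgroup.closure (Set.range (gen K)) := by rw [closure_range_gen]; trivial
  induction ha using AddSubgroup.closure_induction with
  | mem x hx =>
    obtain ⟨b, rfl⟩ := hx
    exact gen_mul_mem_closure_prodGens K b hz
  | zero => rw [zero_mul]; exact zero_mem _
  | add x y _ _ hx hy => rw [add_mul]; exact add_mem hx hy
  | neg x _ hx => rw [neg_mul]; exact neg_mem hx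

/-- **`Iᵐ(K)` is additively generated by the products `(g)((f₁) − (1))⋯((f_m) − (1))`** (as an ideal `Iᵐ` is spanned
by the `m`-fold products of the generators `(f) − (1)` of `I`; the unit factor `(g)` absorbs the module structure).
[cite: Milnor1970, §4 «the elements (a) − (1) form an additive set of generators for the ideal I» (p0015 L10–L12); §5 proof of Lemma 5.7 «Consider any generator η = ((f̄₂) − (1))⋯((f̄ₙ) − (1)) of Iⁿ⁻¹Ē_π» (p0021 L31–L33)] -/
theorem mem_closure_prodGens_of_mem_pow {m : ℕ} {y : WittRing K} (hy : y ∈ fundIdeal K ^ m) :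
    y ∈ AddSubgroup.closure
      {x : WittRing K | ∃ (g : Kˣ) (f : Fin m → Kˣ), gen K g * (List.ofFn fun i => gen K (f i) - 1).prod = x} := by
  classical
  have hmem : y ∈ Submodule.span (WittRing K) ((Set.range fun a : Kˣ => gen K a - 1) ^ m) := by
    have h := hy
    rw [fundIdeal] at h
    change y ∈ Submodule.span (WittRing K) (Set.range fun a : Kˣ => gen K a - 1) ^ m at h
    rwa [Submodule.span_pow] at h
  clear hy
  induction hmem using Submodule.span_induction with
  | mem y h =>
    obtain ⟨f, rfl⟩ := Set.mem_pow.1 h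
    refine AddSubgroup.subset_closure ⟨1, fun i => Classical.choose (f i).2, ?_⟩
    rw [gen_one, one_mul]
    exact congrArg List.prod (List.ofFn_inj.2 (funext fun i => Classical.choose_spec (f i).2))
  | zero => exact zero_mem _
  | add y y' _ _ h h' => exact add_mem h h'
  | smul a y _ h => rw [smul_eq_mul]; exact mul_mem_closure_prodGens K a h

end Generators

/-! ### §3 LEMMA 5.7: exactness at `⊕ Iⁿ⁻¹Ē_π` -/

section Surjective

variable {F : Type*} [Field F]

/-- **The lifts `ζ = ((π) − (1))(g̃)((f̃₁) − (1))⋯((f̃_m) − (1))`**: for `η ∈ Iᵐ(κ_𝔭)` an element `ζ ∈ Iᵐ⁺¹F(t)` with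
`∂_𝔭 ζ = η` and `∂_𝔮 ζ = 0` for every `𝔮 ≠ 𝔭` of degree `≥ deg 𝔭` («where each representative fᵢ has degree < d»).
[cite: Milnor1970, §5 proof of Lemma 5.7 (p0021 L31–L37)] -/
theorem exists_mem_pow_boundaryAtW_eq_and_eq_zero (w : HeightOneSpectrum F[X]) {m : ℕ}
    {x : WittRing (ResidueFieldAt F[X] (RatFunc F) w)} (hx : x ∈ fundIdeal (ResidueFieldAt F[X] (RatFunc F) w) ^ m) :
    ∃ y ∈ fundIdeal (RatFunc F) ^ (m + 1), boundaryAtW F w y = x ∧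
      ∀ w' : HeightOneSpectrum F[X], w' ≠ w → primeDeg F w ≤ primeDeg F w' → boundaryAtW F w' y = 0 := by
  have hx' := mem_closure_prodGens_of_mem_pow (ResidueFieldAt F[X] (RatFunc F) w) hx
  clear hx
  induction hx' using AddSubgroup.closure_induction with
  | mem y hy =>
    obtain ⟨r, s, rfl⟩ := hy
    -- the representatives are units at every prime of degree `≥ deg 𝔭`
    have hval : ∀ (q : (ResidueFieldAt F[X] (RatFunc F) w)ˣ) (w' : HeightOneSpectrum F[X]),
        primeDeg F w ≤ primeDeg F w' → addVal (w'.valuation (RatFunc F)) (repPolyUnit w q) = 0 := fun q w' hle =>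
      addVal_polyUnit_eq_zero_of_natDegree_lt F w' (quotRep_ne_zero w q) (lt_of_lt_of_le (natDegree_quotRep_lt w q) hle)
    set M : WittRing (RatFunc F) :=
      gen (RatFunc F) (repPolyUnit w r) * (List.ofFn fun i => gen (RatFunc F) (repPolyUnit w (s i)) - 1).prod with hM
    have hMpow : M ∈ fundIdeal (RatFunc F) ^ m := Ideal.mul_mem_left _ _ (prod_gen_sub_one_mem (RatFunc F) _)
    have hMcl : ∀ w' : HeightOneSpectrum F[X], primeDeg F w ≤ primeDeg F w' →
        M ∈ Subring.closure (gen (RatFunc F) '' {u : (RatFunc F)ˣ | addVal (w'.valuation (RatFunc F)) u = 0}) :=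
      fun w' hle => gen_mul_prod_mem_closure _ (hval r w' hle) fun i => hval (s i) w' hle
    refine ⟨(gen (RatFunc F) (MilnorK.genUnit F w) - 1) * M, ?_, ?_, fun w' hne hle => ?_⟩
    · rw [pow_succ']
      exact Ideal.mul_mem_mul (gen_sub_one_mem (RatFunc F) _) hMpow
    · rw [boundaryAtW_def, sndResidue_gen_pi_sub_one_mul _ _ (hMcl w le_rfl), hM, rho_gen_mul_prod]
      have e1 : ∀ q : (ResidueFieldAt F[X] (RatFunc F) w)ˣ,
          res (w.valuation (RatFunc F)) (addVal_monicGen F w) (repPolyUnit w q) = q := fun q => resAt_repPolyUnit w q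
      simp only [e1]
    · have hπ' : gen (RatFunc F) (MilnorK.genUnit F w) - 1 ∈
          Subring.closure (gen (RatFunc F) '' {u : (RatFunc F)ˣ | addVal (w'.valuation (RatFunc F)) u = 0}) :=
        sub_mem (Subring.subset_closure ⟨_, addVal_polyUnit_eq_zero_of_not_mem F w' (monicGen_ne_zero F w)
          (monicGen_not_mem_of_ne F (Ne.symm hne)), rfl⟩) (one_mem _)
      rw [boundaryAtW_def]
      exact sndResidue_eq_zero_of_mem_closure _ _ (mul_mem hπ' (hMcl w' hle))
  | zero => exact ⟨0, zero_mem _, map_zero _, fun w' _ _ => map_zero _⟩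
  | add y z _ _ hy hz =>
    obtain ⟨a, haI, ha, ha'⟩ := hy
    obtain ⟨b, hbI, hb, hb'⟩ := hz
    exact ⟨a + b, add_mem haI hbI, by rw [map_add, ha, hb],
      fun w' h1 h2 => by rw [map_add, ha' w' h1 h2, hb' w' h1 h2, add_zero]⟩
  | neg y _ hy =>
    obtain ⟨a, haI, ha, ha'⟩ := hy
    exact ⟨-a, neg_mem haI, by rw [map_neg, ha], fun w' h1 h2 => by rw [map_neg, ha' w' h1 h2, neg_zero]⟩

/-- **«it follows by induction on d₀ that (η_π) is the image of some element in IⁿE»**: every finitely supported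
family `(η_𝔭)`, `η_𝔭 ∈ Iᵐ(κ_𝔭)`, supported in degrees `≤ N`, is `(∂_𝔭 u)_𝔭` with `u ∈ Iᵐ⁺¹F(t)`. [cite: Milnor1970, §5 proof of Lemma 5.7 (p0021 L38–L41)] -/
theorem exists_mem_pow_forall_boundaryAtW_eq_of_support (m N : ℕ) :
    ∀ e : (v : HeightOneSpectrum F[X]) → WittRing (ResidueFieldAt F[X] (RatFunc F) v), {v | e v ≠ 0}.Finite →
      (∀ v, e v ∈ fundIdeal (ResidueFieldAt F[X] (RatFunc F) v) ^ m) →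
      (∀ w : HeightOneSpectrum F[X], N < primeDeg F w → e w = 0) →
      ∃ u ∈ fundIdeal (RatFunc F) ^ (m + 1), ∀ v, boundaryAtW F v u = e v := by
  classical
  induction N with
  | zero =>
    intro e _ _ he
    exact ⟨0, zero_mem _, fun v => by rw [map_zero, he v (primeDeg_pos F v)]⟩
  | succ N ih =>
    intro e hfin hI he
    choose y hyI hy hy' using fun w : HeightOneSpectrum F[X] => exists_mem_pow_boundaryAtW_eq_and_eq_zero w (hI w)
    set T : Finset (HeightOneSpectrum F[X]) := hfin.toFinset.filter fun w => primeDeg F w = N + 1 with hT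
    set a : WittRing (RatFunc F) := ∑ w ∈ T, y w with ha
    have haI : a ∈ fundIdeal (RatFunc F) ^ (m + 1) := Ideal.sum_mem _ fun w _ => hyI w
    -- `∂_{w₀} a = e w₀` in degrees `> N`
    have hcomp : ∀ w₀ : HeightOneSpectrum F[X], N < primeDeg F w₀ → boundaryAtW F w₀ a = e w₀ := by
      intro w₀ hw₀
      rw [ha, map_sum]
      rcases Nat.lt_or_ge (N + 1) (primeDeg F w₀) with hgt | hle
      · rw [he w₀ hgt]
        refine Finset.sum_eq_zero fun w hw => ?_
        have hw' : primeDeg F w = N + 1 := (Finset.mem_filter.1 hw).2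
        exact hy' w w₀ (fun h => by rw [h, hw'] at hgt; exact lt_irrefl _ hgt) (by rw [hw']; exact hgt.le)
      · have hw₀ : primeDeg F w₀ = N + 1 := le_antisymm hle hw₀
        rw [Finset.sum_eq_single w₀]
        · exact hy w₀
        · intro w hw hww₀
          have hw' : primeDeg F w = N + 1 := (Finset.mem_filter.1 hw).2
          exact hy' w w₀ (Ne.symm hww₀) (by rw [hw', hw₀])
        · intro hw₀T
          have he0 : e w₀ = 0 := by
            by_contra hne
            exact hw₀T (Finset.mem_filter.2 ⟨hfin.mem_toFinset.2 hne, hw₀⟩)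
          rw [hy w₀, he0]
    -- correct and descend (the corrections stay in `Iᵐ`: `∂_𝔭(Iᵐ⁺¹E) ⊂ Iᵐ(κ_𝔭)`)
    obtain ⟨u, huI, hu⟩ := ih (fun v => e v - boundaryAtW F v a)
      ((hfin.union (finite_setOf_boundaryAtW_ne_zero F a)).subset fun v hv => by
        by_contra h
        simp only [Set.mem_union, Set.mem_setOf_eq, not_or, not_not] at h
        exact hv (by simp only [h.1, h.2, sub_zero]))
      (fun v => sub_mem (hI v) (boundaryAtW_mem_pow F v haI))
      (fun w hw => by simp only [hcomp w hw, sub_self])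
    exact ⟨u + a, add_mem huI haI, fun v => by rw [map_add, hu, sub_add_cancel]⟩

/-- **LEMMA 5.7, EXACTNESS AT `⊕`: every finitely supported family `(η_𝔭)`, `η_𝔭 ∈ Iᵐ(κ_𝔭)`, is `(∂_𝔭 u)_𝔭` for some
`u ∈ Iᵐ⁺¹F(t)`** (no characteristic assumption). [cite: Milnor1970, §5 Lemma 5.7 «IⁿE → ⊕ Iⁿ⁻¹Ē_π → 0» (p0021 L27–L29), proof (p0021 L31–L41)] -/
theorem exists_mem_pow_forall_boundaryAtW_eq (m : ℕ)
    (e : (v : HeightOneSpectrum F[X]) → WittRing (ResidueFieldAt F[X] (RatFunc F) v)) (he : {v | e v ≠ 0}.Finite)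
    (hI : ∀ v, e v ∈ fundIdeal (ResidueFieldAt F[X] (RatFunc F) v) ^ m) :
    ∃ u ∈ fundIdeal (RatFunc F) ^ (m + 1), ∀ v, boundaryAtW F v u = e v := by
  classical
  refine exists_mem_pow_forall_boundaryAtW_eq_of_support m (he.toFinset.sup (primeDeg F)) e he hI fun w hw => ?_
  by_contra hne
  exact absurd (Finset.le_sup (f := primeDeg F) (he.mem_toFinset.2 hne)) (not_le.2 hw)

end Surjective

/-! ### §4 LEMMA 5.7: exactness at `IⁿF` and in the middle -/

section Middle

variable {F : Type*} [Field F]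

/-- **«ρ maps IⁿE into IⁿF»** turned into the left exactness: `ι(ζ) ∈ IⁿF(t) ↔ ζ ∈ IⁿF` (`ρ ∘ ι = id`). [cite: Milnor1970, §5 proof of Lemma 5.7 «Evidently ρ maps IⁿE into IⁿF, and evidently ρ(ξ) = ζ» (p0022 L8); Lemma 5.7 «0 → IⁿF → IⁿE» (p0021 L27–L29)] -/
theorem mem_pow_iff_constMapW_mem_pow (n : ℕ) (ζ : WittRing F) :
    constMapW F ζ ∈ fundIdeal (RatFunc F) ^ n ↔ ζ ∈ fundIdeal F ^ n := by
  refine ⟨fun h => ?_, fun h => constMapW_mem_pow F h⟩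
  have h' := retraction_mem_pow F h
  rwa [retraction_constMapW] at h'

/-- **LEMMA 5.7, EXACTNESS IN THE MIDDLE** (`char F ≠ 2`): an element of `IⁿF(t)` killed by every `∂_𝔭` is `ι(ζ)` with
`ζ ∈ IⁿF` («According to 5.3, ξ comes from some element ζ of WF. Now apply the homomorphism ρ of §5.4. Evidently ρ
maps IⁿE into IⁿF, and evidently ρ(ξ) = ζ. This proves that ζ ∈ IⁿF»). [cite: Milnor1970, §5 Lemma 5.7 (p0021 L27–L29), proof (p0022 L5–L10)] -/
theorem exists_mem_pow_constMapW_eq (h2 : (2 : F) ≠ 0) {n : ℕ} {ξ : WittRing (RatFunc F)}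
    (hξ : ξ ∈ fundIdeal (RatFunc F) ^ n) (h0 : ∀ v : HeightOneSpectrum F[X], boundaryAtW F v ξ = 0) :
    ∃ ζ ∈ fundIdeal F ^ n, constMapW F ζ = ξ := by
  obtain ⟨ζ, rfl⟩ := (forall_boundaryAtW_eq_zero_iff h2 ξ).1 h0
  exact ⟨ζ, (mem_pow_iff_constMapW_mem_pow n ζ).1 hξ, rfl⟩

/-- **LEMMA 5.7 packaged** (`char F ≠ 2`): `w ↦ (ρ w, (∂_𝔭 w)_𝔭)` restricts to a bijection from `Iⁿ⁺¹F(t)` onto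
`Iⁿ⁺¹F × ⊕_𝔭 Iⁿ(κ_𝔭)` — «0 → IⁿF → IⁿE → ⊕ Iⁿ⁻¹Ē_π → 0» together with the splitting `ρ`. [cite: Milnor1970, §5 Lemma 5.7 (p0021 L27–L29) and its proof (p0021 L30 – p0022 L10)] -/
theorem bijOn_pow_retraction_prod_boundaryFamilyW (h2 : (2 : F) ≠ 0) (n : ℕ) :
    Set.BijOn (fun w : WittRing (RatFunc F) => (retraction F w, boundaryFamilyW F w))
      (fundIdeal (RatFunc F) ^ (n + 1) : Ideal (WittRing (RatFunc F)))
      ((fundIdeal F ^ (n + 1) : Ideal (WittRing F)) ×ˢ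
        {e : FinSuppFamilyW F | ∀ v, e.1 v ∈ fundIdeal (ResidueFieldAt F[X] (RatFunc F) v) ^ n}) := by
  refine ⟨fun w hw => ?_, fun w₁ _ w₂ _ h => (bijective_retraction_prod_boundaryFamilyW h2).1 h, fun p hp => ?_⟩
  · exact ⟨retraction_mem_pow F hw, fun v => boundaryAtW_mem_pow F v hw⟩
  · obtain ⟨β, e⟩ := p
    obtain ⟨hβ, he⟩ := hp
    obtain ⟨u, huI, hu⟩ := exists_mem_pow_forall_boundaryAtW_eq n e.1 e.2 he
    refine ⟨u + constMapW F (β - retraction F u), add_mem huI (constMapW_mem_pow F (sub_mem hβ (retraction_mem_pow F huI))), ?_⟩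
    simp only [Prod.mk.injEq]
    refine ⟨by rw [map_add, retraction_constMapW, add_sub_cancel], Subtype.ext (funext fun v => ?_)⟩
    rw [boundaryFamilyW_apply, map_add, boundaryAtW_constMapW, add_zero, hu]

end Middle

end WittRing

end Literature.RingTheory.KTheory

end
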